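import Summits.Ventures.PercRepro2.CaseOneStarCertT1
import Summits.Ventures.PercRepro2.CaseOneGadgetUWA1BBlockI0
import Summits.Ventures.PercRepro2.CaseOneGadgetUWA1BBlockI1
import Summits.Ventures.PercRepro2.CaseOneGadgetUWA1BBlockI2
import Summits.Ventures.PercRepro2.CaseOneGadgetUWA1BBlockI3
import Summits.Ventures.PercRepro2.CaseOneGadgetUWA1BBlockI4
import Summits.Ventures.PercRepro2.CaseOneGadgetUWA1BBlockI5
import Summits.Ventures.PercRepro2.CaseOneGadgetUWA1BBlockI6
import Summits.Ventures.PercRepro2.CaseOneGadgetUWA1BBlockI7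
import Summits.Ventures.PercRepro2.CaseOneGadgetUWA1BBlockI8
import Summits.Ventures.PercRepro2.CaseOneGadgetUWA1BBlockI9
import Summits.Ventures.PercRepro2.CaseOneGadgetUWA1BBlockI10
import Summits.Ventures.PercRepro2.CaseOneGadgetUWA1BBlockI11
import Summits.Ventures.PercRepro2.CaseOneGadgetUWA1BBlockI12
import Summits.Ventures.PercRepro2.CaseOneGadgetUWA1BBlockI13
import Summits.Ventures.PercRepro2.CaseOneGadgetUWA1BBlockI14
import Summits.Ventures.PercRepro2.CaseOneStarFactsB

/-!
# The gadget `u ~ {w, a₁, b}`, `w ~ {u, a₂, o}` (uwa1b): the cell certificates of `iAB5` (part 32d)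
(blind cell PercRepro2, p1 g34; the fourth gadget anchor of the six-form calculus — all six forms of the uwa1b gadget
as plain SFacts-cone certificate chains, generated by mining/p1/g34/uwa1b/genu.py = p1 g33's gent_uwa1.py / g25's
geno.py re-targeted; P1-G33 §6–§6″, P1-G34)

Each `eBABI ijk kl` is a nonnegative combination of `(pairwise atom) × (cell)` and cubic cell monomials — or, for the degree-4 ones, `M × eBABI ijk kl` (`M = Σ cᵢ` the total cell mass) is a nonnegative combination of `(atom) × (cell) × (cell)` and quartic cell monomials, then `SFacts.nonneg_of_sum_mul` (`CaseOneStarCertT1`) — exact LP certificates (kit j319447, every certificate re-verified exactly; data/p1/g33/gcerts_i_uwa1b.json, form `i`), here as exact `linear_combination`s over `SFacts` (the rational coefficients cleared by their common denominator). -/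

namespace Summit.Ventures.PercRepro2

namespace CaseOne

section CertABI32d
variable {R : Type*} [Field R] [LinearOrder R] [IsStrictOrderedRing R]

set_option maxHeartbeats 0 in
/-- `eBABI22323 ≥ 0`: the combination is identically zero (`ring`). -/
lemma eBABI22323_nonneg (m : SCells R) (_hf : SFactsB m) : 0 ≤ eBABI22323 m := by
  have h : eBABI22323 m = 0 := by
    unfold eBABI22323 cBABI00123 cBABI00223 cBABI01023 cBABI01123 cBABI01223 cBABI01323 cBABI02023 cBABI02123 cBABI02223 cBABI02323 cBABI10023 cBABI10123 cBABI10223 cBABI11023 cBABI11123 cBABI11223 cBABI11323 cBABI12023 cBABI12123 cBABI12223 cBABI12323 cBABI20023 cBABI20123 cBABI20223 cBABI20323 cBABI21023 cBABI21123 cBABI21223 cBABI21323 cBABI22023 cBABI22123 cBABI22223 cBABI22323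
    ring
  linarith [h]

set_option maxHeartbeats 0 in
/-- `eBABI22330 ≥ 0`: the combination is identically zero (`ring`). -/
lemma eBABI22330_nonneg (m : SCells R) (_hf : SFactsB m) : 0 ≤ eBABI22330 m := by
  have h : eBABI22330 m = 0 := by
    unfold eBABI22330 cBABI00130 cBABI00230 cBABI01030 cBABI01130 cBABI01230 cBABI01330 cBABI02030 cBABI02130 cBABI02230 cBABI02330 cBABI10130 cBABI10230 cBABI11030 cBABI11130 cBABI11230 cBABI11330 cBABI12030 cBABI12130 cBABI12230 cBABI12330 cBABI20130 cBABI20230 cBABI21030 cBABI21130 cBABI21230 cBABI21330 cBABI22030 cBABI22130 cBABI22230 cBABI22330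
    ring
  linarith [h]

end CertABI32d

end CaseOne

end Summit.Ventures.PercRepro2
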